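import Mathlib
import Literature.Computability.Complexity.Circuit
import Literature.Computability.Complexity.ConstantDepth
import Literature.Computability.Complexity.Promise
import Literature.Computability.Complexity.MCSPHardnessKabanetsCaiProofs
import Literature.Computability.MetaComplexity.MCSP
import Literature.Computability.MetaComplexity.MagnificationFrontierA
import HarnessLib

/-!
# `MCSP[n^c, n^{2c}] ∉ AC⁰_d[poly(N)]` for every depth `d` (Chen–Hirahara–Oliveira–Pich–Rajgopal–Santhanam 2019/2020, §5.2.1 — the oracle-free instance)

**Source (held, read on the page).** L. Chen, S. Hirahara, I. C. Oliveira, J. Pich, N. Rajgopal,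
R. Santhanam, *Beyond natural proofs: hardness magnification and locality*, arXiv:1911.08297
(ITCS 2020; J. ACM 69 (2022)), §5.2 "Lower Bounds Below Magnification Threshold", §5.2.1
"`AC⁰` Lower Bounds via Pseudorandom Restrictions" (materialised LaTeX text
`paper:arxiv-1911.08297`, chunk p0028 L7–17; the theorem carries the LaTeX label
`thm:localize-MCSP-AC0` and is numbered **Theorem 52** in the arXiv text — the ITCS/JACM numbering
may differ, cite by section and label):

> "We use `AC_d[O_1, O_2, …, O_d]` to denote `AC_d` circuits extended with arbitrary oracles, such
> that oracle gates on the `i`-th level (the gates whose distance from the inputs is `i`) have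
> fan-in at most `O_i`.
> **Theorem 52.** There is a constant `c` such that for all `ε > 0`, constants `d`, and
> `O_1, O_2, …, O_d` such that `∏_{i=1}^{d} O_i ≤ N/(log N)^{ω(1)}`,
> `MCSP[n^c, n^{2c}] ∉ AC_d[O_1, O_2, …, O_d][poly(N)]`."

(The proof, p0029 L29–34 and L70–78 of the same text, shows the stronger size bound
`S = Ω(N^{log N})` via `k`-wise independent pseudorandom restrictions, and fixes `c` only through
"`x*` has a circuit of `poly(n) · log N = poly(n) ≤ n^c` size (now we set `c`)".)

Conventions of the source (§2, chunk p0010): `N = 2^n`; "`Circuit[s]` denotes fan-in two Boolean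
circuits of size at most `s` where we count the number of gates" (L8); Def. 6 (L50–59):
`MCSP[(s,σ),(t,ε)]` on inputs of length `N = 2^n` — YES: some circuit of size `s(n)`
`(1−σ)`-approximates `f_y`; NO: no circuit of size `t(n)` `(1−ε)`-approximates `f_y`;
"We refer to `MCSP[(s,0),(t,0)]` as `MCSP[s,t]`" (so YES = complexity `≤ s(n)`, NO = complexity
`> t(n)`); "For a circuit class `𝒞`, `𝒞[s]` denotes circuits from `𝒞` of size at most `s`" (L11);
`AC_d` = unbounded fan-in `∧/∨/¬` circuits of depth `d` (levels counted by distance from the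
inputs, L13 of p0028), non-uniform.

**What is typed here, and in which direction.** ONLY the ORACLE-FREE instance of the theorem:
a depth-`d` circuit WITHOUT oracle gates is an `AC_d[O_1, …, O_d]` circuit for every admissible
choice of the fan-ins `O_i` (take all `O_i = 1`, product `1 ≤ N/(log N)^{ω(1)}`), so the print
gives in particular: *there is a constant `c` such that for every constant `d`,
`MCSP[n^c, n^{2c}]` is not computed (on its promise) by polynomial-size `AC⁰` circuits of depth
`d`.* The tree statement `chop_thm52_oracleFree` renders this over EXISTING vocabulary:
the promise problem `gapMCSP (fun n => n ^ c) (fun n => n ^ (2 * c))`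
(`Literature/Computability/MetaComplexity/MCSP.lean`: YES = truth tables with
`circuitSizeOver B2 f ≤ n^c` = `MCSPSize`, NO = truth tables with `n^{2c} < circuitSizeOver B2 f`;
print's "fan-in two Boolean circuits, counting gates" is identified with the tree's `B₂`-measure
`circuitSizeOver B2`, the standing `MCSPSize` convention of every `MCSP[s]` fact in this directory)
is not a member of `promiseLift (ACd d)` (`Literature/Computability/Complexity/Promise.lean`,
`ConstantDepth.lean`): no language decided at EVERY input length by an `acBasis` circuit family
of `acDepth ≤ d` (negations free in depth) and size `≤ p(len)` for a polynomial `p` (ALL gates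
counted, negations included) separates YES from NO.
PRINTED ⇒ TYPED: a tree separator would be, at each length `N = 2^n`, a depth-`≤ d` polynomial-size
`∧/∨/¬` circuit correct on the promise of `MCSP[n^c, n^{2c}]`; pushing its free negations to the
inputs (De Morgan) keeps the number of levels `≤ d` and at most doubles the `∧/∨` gates, giving a
standard `AC_d[poly(N)]` circuit (pad to depth exactly `d` if the print means exact depth) — which
the print forbids for all large `N`. The tree class is, if anything, SMALLER than print's (it
demands correctness at every length, not only eventually, and counts negation gates in the size),
so non-membership in it is the WEAKER claim. The oracle part of the theorem (its actual point:
the lower bound "localizes") is NOT typed — the tree has no oracle-`AC⁰` circuit model with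
level-wise fan-in budgets; it is quoted above for the census's barrier column only.

**Why this fact is vendored (magnification gap census, host summit `PneNP`).** It is the printed
WORST-CASE lower bound nearest to the threshold of Oliveira–Santhanam's Cor. 29 (tree fact
`OliveiraSanthanam2018.cor29`, census row R68, provisional id): there the hypothesis is a
ZERO-ERROR AVERAGE-CASE lower bound for `MCSP[n^c]` against `AC⁰[N^γ]`; here the known bound is
worst-case (on the promise problem `MCSP[n^c, n^{2c}]`, hence for the language `MCSP[n^c]`, see
`chop_thm52_oracleFree.MCSPSize_pow_not_mem_ACd`) against `AC⁰_d[poly(N)]`. The two are in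
different models (worst-case vs zero-error average-case; the census records MODEL-MISMATCH, no
number); this file supplies the typed K side. API proved here: `MCSP[a]` separates `MCSP[a,b]`
whenever `a ≤ b` (`gapMCSP_mem_promiseLift_of_MCSPSize_mem`), hence the language corollaries
`…MCSPSize_pow_not_mem_ACd` / `…_not_mem_AC0` and the promise corollary against
`promiseLift AC0`; non-vacuity (F1): `promiseLift (ACd d)` is inhabited for `d ≥ 1` (the existing
`ofLanguage_headLang_mem_promiseLift_ACd` of `MagnificationFrontierA.lean`, re-checked here as an
`example`), the YES side of the promise problem is inhabited at every `n ≥ 1` (constant truth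
tables) and the NO side whenever `9 (n + n^{2c} + 2)² < 2^n` (Shannon count,
`KabanetsCai.exists_lt_circuitSizeOver`), e.g. `c = 1`, `n = 30`.

Searches run for an existing rendering (none): `lean search 'thm52|localize-MCSP|thm:localize'`
(123 hits, all Jia–Šverák/KNSS "Thm 5.2" and Hirahara 2022 Thm 5.2 — unrelated) and
`lean search 'gapMCSP \(fun n => n \^|n\^\{2c\}'` (prose mentions only: the barrier column of
`MagnificationGapCensus.lean` and the R68 docstrings of `MagnificationGapCensus/AverageCaseCircuits.lean`;
no typed statement); `MagnificationFrontierA.lean` has CHOPRS Thm. 14/15 and Frontier A,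
`Literature/Barriers/PneNP/Locality*.lean` Frontier E / Thm. 47-type localizations only.
-/

namespace Literature.Computability.MetaComplexity

open _root_.Computability Complexity

/-! ### The named fact -/

/-- **CHOPRS Theorem 52 (arXiv:1911.08297 §5.2.1, label `thm:localize-MCSP-AC0`), oracle-free
instance.** Verbatim: "There is a constant `c` such that for all `ε > 0`, constants `d`, and
`O_1, O_2, …, O_d` such that `∏_{i=1}^{d} O_i ≤ N/(log N)^{ω(1)}`,
`MCSP[n^c, n^{2c}] ∉ AC_d[O_1, O_2, …, O_d][poly(N)]`." Typed (the instance without oracle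
gates, implied by the print — see the module docstring for the direction): there is a constant
`c` such that for every depth `d` the promise problem `MCSP[n^c, n^{2c}]`
(`gapMCSP (· ^ c) (· ^ (2c))`, `B₂`-gate-count measure) has no separating language in `ACd d`
(depth-`d`, polynomial-size `∧/∨/¬` circuit families deciding at every length). Unproved
published result, used as a hypothesis `(hK : chop_thm52_oracleFree)`. [cite: arXiv191108297, §5.2.1 Thm. 52 (thm:localize-MCSP-AC0)] -/
def chop_thm52_oracleFree : Prop :=
  ∃ c : ℕ, ∀ d : ℕ, gapMCSP (fun n => n ^ c) (fun n => n ^ (2 * c)) ∉ promiseLift (ACd d)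

/-! ### API: the gap problem and its separators -/

/-- `n^c ≤ n^{2c}` for all naturals (also at `n = 0`). [folklore] -/
theorem pow_le_pow_two_mul (n c : ℕ) : n ^ c ≤ n ^ (2 * c) := by
  rw [two_mul, pow_add]
  rcases Nat.eq_zero_or_pos (n ^ c) with h | h
  · simp [h]
  · exact Nat.le_mul_of_pos_right _ h

/-- `MCSP[n^c, n^{2c}]` is a genuine (disjoint) promise problem (CHOPRS Def. 6 requires `s ≤ t`).
[cite: arXiv191108297, §2 Def. 6] -/
theorem gapMCSP_pow_disjoint (c : ℕ) :
    (gapMCSP (fun n => n ^ c) (fun n => n ^ (2 * c))).Disjoint :=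
  gapMCSP_disjoint fun n => pow_le_pow_two_mul n c

/-- **`MCSP[a]` separates `MCSP[a, b]` when `a ≤ b`.** If the language `MCSP[a]` lies in a class
`C`, then the promise problem `MCSP[a, b]` lies in `promiseLift C` (its YES part is `MCSP[a]`, its
NO part is disjoint from `MCSP[a]`). [folklore] -/
theorem gapMCSP_mem_promiseLift_of_MCSPSize_mem {C : Set (Language Bool)} {a b : ℕ → ℕ}
    (hab : ∀ n, a n ≤ b n) (hL : MCSPSize a ∈ C) : gapMCSP a b ∈ promiseLift C := by
  refine ⟨MCSPSize a, hL, fun w hw => hw, fun w hno hyes => ?_⟩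
  exact Set.disjoint_left.1 (gapMCSP_disjoint hab) hyes hno

/-- Contrapositive: if `MCSP[a, b] ∉ promiseLift C` (with `a ≤ b`) then the language `MCSP[a]` is
not in `C`. [folklore] -/
theorem MCSPSize_not_mem_of_gapMCSP_not_mem {C : Set (Language Bool)} {a b : ℕ → ℕ}
    (hab : ∀ n, a n ≤ b n) (h : gapMCSP a b ∉ promiseLift C) : MCSPSize a ∉ C :=
  fun hL => h (gapMCSP_mem_promiseLift_of_MCSPSize_mem hab hL)

/-- A promise problem outside `promiseLift (ACd d)` for every `d` is outside `promiseLift AC⁰`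
(`AC⁰ = ⋃_d AC⁰_d`, `AC0_eq_iUnion_ACd`). [folklore] -/
theorem not_mem_promiseLift_AC0_of_forall_ACd {Q : PromiseProblem}
    (h : ∀ d : ℕ, Q ∉ promiseLift (ACd d)) : Q ∉ promiseLift AC0 := by
  rintro ⟨L, hL, hy, hn⟩
  rw [AC0_eq_iUnion_ACd, Set.mem_iUnion] at hL
  obtain ⟨d, hd⟩ := hL
  exact h d ⟨L, hd, hy, hn⟩

/-! ### Corollaries of the fact -/

/-- Under the fact: for its constant `c`, the LANGUAGE `MCSP[n^c]` is in no `AC⁰_d`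
(worst-case constant-depth lower bound for fixed-polynomial MCSP, every depth).
[cite: arXiv191108297, §5.2.1 Thm. 52 (thm:localize-MCSP-AC0)] -/
theorem chop_thm52_oracleFree.MCSPSize_pow_not_mem_ACd (hK : chop_thm52_oracleFree) :
    ∃ c : ℕ, ∀ d : ℕ, MCSPSize (fun n => n ^ c) ∉ ACd d := by
  obtain ⟨c, hc⟩ := hK
  exact ⟨c, fun d => MCSPSize_not_mem_of_gapMCSP_not_mem (fun n => pow_le_pow_two_mul n c) (hc d)⟩

/-- Under the fact: `MCSP[n^c] ∉ AC⁰` for its constant `c`.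
[cite: arXiv191108297, §5.2.1 Thm. 52 (thm:localize-MCSP-AC0)] -/
theorem chop_thm52_oracleFree.MCSPSize_pow_not_mem_AC0 (hK : chop_thm52_oracleFree) :
    ∃ c : ℕ, MCSPSize (fun n => n ^ c) ∉ AC0 := by
  obtain ⟨c, hc⟩ := hK.MCSPSize_pow_not_mem_ACd
  refine ⟨c, fun hmem => ?_⟩
  rw [AC0_eq_iUnion_ACd, Set.mem_iUnion] at hmem
  obtain ⟨d, hd⟩ := hmem
  exact hc d hd

/-- Under the fact: the promise problem `MCSP[n^c, n^{2c}]` is not in `promiseLift AC⁰`.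
[cite: arXiv191108297, §5.2.1 Thm. 52 (thm:localize-MCSP-AC0)] -/
theorem chop_thm52_oracleFree.gapMCSP_pow_not_mem_promiseLift_AC0 (hK : chop_thm52_oracleFree) :
    ∃ c : ℕ, gapMCSP (fun n => n ^ c) (fun n => n ^ (2 * c)) ∉ promiseLift AC0 := by
  obtain ⟨c, hc⟩ := hK
  exact ⟨c, not_mem_promiseLift_AC0_of_forall_ACd hc⟩

/-! ### API: non-vacuity (F1) -/

/- Device-class non-vacuity: for `d ≥ 1`, `promiseLift (ACd d)` contains the trivial-promise
problem of `headLang` — this is the EXISTING lemma `ofLanguage_headLang_mem_promiseLift_ACd`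
(`MagnificationFrontierA.lean`, from `headLang_mem_ACd`); so `chop_thm52_oracleFree` is not true
for the empty reason at any depth `d ≥ 1` (at `d = 0` the tree class `ACd 0` decides no
non-trivial language and the instance is idle, as is print's `AC_0`). -/
example {d : ℕ} (hd : 1 ≤ d) : PromiseProblem.ofLanguage headLang ∈ promiseLift (ACd d) :=
  ofLanguage_headLang_mem_promiseLift_ACd hd

/-- The YES side of `MCSP[n^c, n^{2c}]` is inhabited at every `n ≥ 1`: the constant-`1` truth
table has a one-gate `B₂` circuit. [folklore] -/
theorem replicate_true_mem_gapMCSP_pow_yes (c : ℕ) {n : ℕ} (hn : 1 ≤ n) :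
    List.replicate (2 ^ n) true ∈ (gapMCSP (fun n => n ^ c) (fun n => n ^ (2 * c))).yes := by
  have htt : List.replicate (2 ^ n) true = truthTable (fun _ : Fin n → Bool => true) := by
    simp [truthTable, List.ofFn_const]
  rw [gapMCSP_yes, htt, truthTable_mem_MCSPSize_iff]
  refine (circuitSizeOver_le_of_computes (Circuit.const (Fin n) true) ?_ fun x => rfl).trans ?_
  · intro g hg
    simp only [Circuit.const, List.mem_singleton] at hg
    subst hg
    show (0 : ℕ) ≤ 2
    exact Nat.zero_le _
  · simpa using Nat.one_le_pow c n hn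

/-- The NO side of `MCSP[n^c, n^{2c}]` is inhabited whenever `9 (n + n^{2c} + 2)² < 2ⁿ` (Shannon's
count in the tree's form, `KabanetsCai.exists_lt_circuitSizeOver`): some truth table of length
`2ⁿ` has `B₂`-complexity `> n^{2c}`. [folklore] -/
theorem exists_truthTable_mem_gapMCSP_pow_no (c : ℕ) {n : ℕ}
    (h : 9 * (n + n ^ (2 * c) + 2) ^ 2 < 2 ^ n) :
    ∃ f : (Fin n → Bool) → Bool,
      truthTable f ∈ (gapMCSP (fun n => n ^ c) (fun n => n ^ (2 * c))).no := by
  obtain ⟨f, hf⟩ := KabanetsCai.exists_lt_circuitSizeOver n (n ^ (2 * c)) h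
  exact ⟨f, (truthTable_mem_gapMCSP_no_iff _ _ f).2 hf⟩

/-- Instance: at `c = 1`, `n = 30` (`N = 2³⁰`) both sides of `MCSP[n, n²]` are inhabited
(`9 · (30 + 900 + 2)² = 7 817 616 < 2³⁰`). [folklore] -/
theorem gapMCSP_pow_one_inhabited_at_30 :
    (List.replicate (2 ^ 30) true ∈ (gapMCSP (fun n => n ^ 1) (fun n => n ^ (2 * 1))).yes) ∧
      ∃ f : (Fin 30 → Bool) → Bool,
        truthTable f ∈ (gapMCSP (fun n => n ^ 1) (fun n => n ^ (2 * 1))).no :=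
  ⟨replicate_true_mem_gapMCSP_pow_yes 1 (by norm_num),
    exists_truthTable_mem_gapMCSP_pow_no 1 (by norm_num)⟩

end Literature.Computability.MetaComplexity
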